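import Literature.Combinatorics.Designs.DifferenceSetMultiplier
import Mathlib.Data.ZMod.Basic
import Mathlib.Tactic.NormNum.Prime

/-!
# No cyclic projective plane of order 10: no planar `(111, 11, 1)` difference set in `ℤ/111` (kernel)
Framing: lottery ticket; floor = certified bounds/negative ranges.

Cell `pub-namedobj`, target M (three MOLS of order 10). Context, not a bound line: a cyclic (Singer-type) projective
plane of order 10 would be a planar `(111, 11, 1)` difference set and would yield a complete set of 9 MOLS(10); order
10 has no plane at all (Lam–Thiel–Swiercz 1989, a computer proof outside the kernel), and the printed floor for the
census is `N(10) ≤ 6`. Here the CYCLIC case is put in the kernel by hand (Hall 1947): `no_planar_differenceSet_111`.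
Proof: Hall's multiplier theorem (Literature `DifferenceSetMultiplier`, Lander 1983 Thm 5.3) makes `2 ∣ n = 10` a
multiplier; it fixes the translate `D'` with element-sum `0` (Lander Thm 5.10); reduce modulo `37`, where `2` is a
primitive root (`orderOf_two_zmod37`): an `x ∈ D'` with non-zero residue has `36` distinct multiples `2^i x` in `D'`,
too many, so `D' ⊆ ker(ℤ/111 → ℤ/37)`, which has `3 < 11` elements. Companion of `PP12/NoOrder157.lean` (order 12).
Kernel replication of print; zero compute; no `sorry`, no new axioms.
-/
namespace Summit.Ventures.DiscreteObjects.MOLS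

open Finset
open Literature.Combinatorics.Designs.DifferenceSets

/-- `111 = 3 · 37` -/
theorem dvd_37_111 : (37 : ℕ) ∣ 111 := by norm_num

/-- the reduction map `ℤ/111 → ℤ/37` (local notation) -/
local notation "proj37" => (ZMod.castHom dvd_37_111 (ZMod 37) : ZMod 111 →+* ZMod 37)

/-- the kernel of the reduction `ℤ/111 → ℤ/37` has three elements. -/
theorem card_ker_proj37 : (univ.filter fun h : ZMod 111 => proj37 h = 0).card = 3 := by
  have : (univ.filter fun h : ZMod 111 => proj37 h = 0) =
      (Finset.range 3).image fun i => ((37 * i : ℕ) : ZMod 111) := by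
    ext h
    simp only [mem_filter, mem_univ, true_and, mem_image, mem_range, ZMod.castHom_apply]
    constructor
    · intro hh
      have hval : (h.val : ZMod 37) = 0 := by rw [ZMod.cast_eq_val] at hh; exact hh
      rw [ZMod.natCast_eq_zero_iff] at hval
      obtain ⟨i, hi⟩ := hval
      refine ⟨i, ?_, ?_⟩
      · have := ZMod.val_lt h; omega
      · rw [← hi, ZMod.natCast_zmod_val]
    · rintro ⟨i, hi, rfl⟩
      rw [ZMod.cast_eq_val, ZMod.val_natCast, ZMod.natCast_eq_zero_iff]
      rw [Nat.mod_eq_of_lt (by omega)]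
      exact Dvd.intro i rfl
  rw [this, Finset.card_image_of_injOn, Finset.card_range]
  intro i hi j hj hij
  simp only [coe_range, Set.mem_Iio] at hi hj
  have h := (ZMod.natCast_eq_natCast_iff' _ _ 111).mp hij
  rw [Nat.mod_eq_of_lt (by omega), Nat.mod_eq_of_lt (by omega)] at h
  omega

/-- powers of `2` modulo `37`, evaluated in `ℕ` -/
theorem two_pow_zmod37_ne_one {e : ℕ} (h : 2 ^ e % 37 ≠ 1) : (2 : ZMod 37) ^ e ≠ 1 := by
  intro h1
  apply h
  have : ((2 ^ e : ℕ) : ZMod 37) = ((1 : ℕ) : ZMod 37) := by push_cast; exact h1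
  rw [ZMod.natCast_eq_natCast_iff'] at this
  exact this

/-- `2` is a primitive root modulo `37`. -/
theorem orderOf_two_zmod37 : orderOf (2 : ZMod 37) = 36 := by
  refine orderOf_eq_of_pow_and_pow_div_prime (by norm_num) ?_ ?_
  · have h : ((2 ^ 36 : ℕ) : ZMod 37) = ((1 : ℕ) : ZMod 37) := by
      rw [ZMod.natCast_eq_natCast_iff']; decide
    rw [Nat.cast_pow, Nat.cast_ofNat, Nat.cast_one] at h
    exact h
  · intro q hq hqd
    have h36 : (36 : ℕ) = 2 ^ 2 * 3 ^ 2 := by norm_num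
    have hq' : q ∣ 2 ^ 2 * 3 ^ 2 := h36 ▸ hqd
    rcases (Nat.Prime.dvd_mul hq).mp hq' with h | h
    · have := (Nat.prime_dvd_prime_iff_eq hq Nat.prime_two).mp (hq.dvd_of_dvd_pow h)
      subst this
      exact two_pow_zmod37_ne_one (by decide)
    · have := (Nat.prime_dvd_prime_iff_eq hq Nat.prime_three).mp (hq.dvd_of_dvd_pow h)
      subst this
      exact two_pow_zmod37_ne_one (by decide)

/-- **No cyclic projective plane of order 10: there is no planar `(111, 11, 1)` difference set in `ℤ/111`**
(kernel; Hall 1947). By Hall's multiplier theorem (Literature `DifferenceSetMultiplier`) `2 ∣ 10 = n` is a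
multiplier and fixes the translate `D'` with element-sum `0`; reducing modulo `37`, where `2` is a primitive root,
an element of `D'` with non-zero residue would have `36 > 11` distinct multiples `2^i x` inside `D'`, so `D'` lies
in the three-element kernel — but `|D'| = 11`. (A cyclic plane of order 10 would give a complete set of 9 MOLS(10);
order 10 itself has no plane at all by Lam–Thiel–Swiercz 1989, a computer proof not in the kernel.) -/
theorem no_planar_differenceSet_111 (D : Finset (ZMod 111)) (hD : IsDifferenceSet D 1) (hcard : D.card = 11) :
    False := by
  classical
  have hcardG : Fintype.card (ZMod 111) = 111 := ZMod.card 111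
  -- sum-zero translate, fixed by the multiplier 2
  have hcop : (D.card).Coprime (Fintype.card (ZMod 111)) := by rw [hcard, hcardG]; norm_num
  obtain ⟨g, hg⟩ := IsDifferenceSet.exists_translate_sum_eq_zero D hcop
  set D' := D.image fun x => x + g with hD'def
  have hD' : IsDifferenceSet D' 1 := hD.image_add_right g
  have hcard' : D'.card = 11 := by rw [hD'def, Finset.card_image_of_injective _ (add_left_injective g), hcard]
  have hcop' : (D'.card).Coprime (Fintype.card (ZMod 111)) := by rw [hcard', hcardG]; norm_num
  have h56 : (56 : ZMod 111) * 2 = 1 := by decide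
  have hinj : Function.Injective fun x : ZMod 111 => (2 : ℕ) • x := by
    intro a b hab
    simp only [nsmul_eq_mul, Nat.cast_ofNat] at hab
    calc a = (56 * 2) * a := by rw [h56, one_mul]
      _ = 56 * (2 * a) := by ring
      _ = 56 * (2 * b) := by rw [hab]
      _ = (56 * 2) * b := by ring
      _ = b := by rw [h56, one_mul]
  have h2 : D'.image (fun x => (2 : ℕ) • x) = D' := by
    obtain ⟨s, hs⟩ := hD'.multiplier Nat.prime_two (by norm_num) (by norm_num [hcard']) (by norm_num [hcard'])
      (by norm_num [hcardG])
    exact IsDifferenceSet.image_nsmul_eq_self_of_sum_eq_zero D' hcop' hg hinj hs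
  have hmul : ∀ x ∈ D', (2 : ZMod 111) * x ∈ D' := by
    intro x hx
    have : (2 : ℕ) • x ∈ D'.image (fun x => (2 : ℕ) • x) := mem_image_of_mem _ hx
    rw [h2] at this
    simpa [nsmul_eq_mul] using this
  have hpow : ∀ n : ℕ, ∀ x ∈ D', (2 : ZMod 111) ^ n * x ∈ D' := by
    intro n
    induction n with
    | zero => intro x hx; simpa using hx
    | succ n ih => intro x hx; rw [pow_succ', mul_assoc]; exact hmul _ (ih x hx)
  by_cases hcase : ∃ x ∈ D', proj37 x ≠ 0
  · -- an orbit of 36 elements inside D'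
    obtain ⟨x, hx, hx0⟩ := hcase
    have hsub : (Finset.range 36).image (fun n => (2 : ZMod 111) ^ n * x) ⊆ D' := by
      intro y hy
      obtain ⟨n, -, rfl⟩ := mem_image.mp hy
      exact hpow n x hx
    have hinjOn : Set.InjOn (fun n => (2 : ZMod 111) ^ n * x) (Finset.range 36 : Set ℕ) := by
      intro a ha b hb hab
      have hab' : proj37 ((2 : ZMod 111) ^ a * x) = proj37 ((2 : ZMod 111) ^ b * x) := by
        simp only at hab; rw [hab]
      rw [map_mul, map_mul, map_pow, map_pow, map_ofNat] at hab'
      haveI : Fact (Nat.Prime 37) := ⟨by norm_num⟩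
      have hab'' : (2 : ZMod 37) ^ a = 2 ^ b := mul_right_cancel₀ hx0 hab'
      have ha' : a ∈ Set.Iio (orderOf (2 : ZMod 37)) := by rw [orderOf_two_zmod37]; simpa using ha
      have hb' : b ∈ Set.Iio (orderOf (2 : ZMod 37)) := by rw [orderOf_two_zmod37]; simpa using hb
      exact pow_injOn_Iio_orderOf ha' hb' hab''
    have h36 : ((Finset.range 36).image fun n => (2 : ZMod 111) ^ n * x).card = 36 := by
      rw [Finset.card_image_of_injOn hinjOn, Finset.card_range]
    have := Finset.card_le_card hsub
    rw [h36, hcard'] at this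
    omega
  · -- otherwise D' sits inside the kernel of size 3
    push Not at hcase
    have hsub : D' ⊆ univ.filter fun h : ZMod 111 => proj37 h = 0 := by
      intro x hx
      exact mem_filter.mpr ⟨mem_univ _, hcase x hx⟩
    have := Finset.card_le_card hsub
    rw [card_ker_proj37, hcard'] at this
    omega

end Summit.Ventures.DiscreteObjects.MOLS
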